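import Summits.QuantumFields.YangMills.Theorems.FluctuationComparisonRegPrIntLS2BetaChartContCarrier
import Summits.QuantumFields.YangMills.Theorems.FluctuationComparisonRegPrIntLWregChartChainCovariance
import Literature.MathematicalPhysics.QuantumFieldTheory.Balaban1983to89.B12RTGaugeInvariance254
import HarnessLib

/-!
# CHART∞ · V-b1 (LINE g18-1 `semiclassical_s2beta`, organ S2β, LAPLACE row): GAUGE COVARIANCE OF THE FIBRED CHART — the chart map, and the Jacobian a.e.

R3 = Bałaban's UV-stability programme on the finite 3-torus, gauge group `SU(N)` (generic `(P, N)` here) — NOT d = 4, NOT infinite volume, NOT a mass gap,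
NOT Clay; the Yang–Mills gap is NOT proved by anything in this file.  Helper toward crux `stmt-QuantumFields-20520` (`FluctuationComparisonRegPrIntL`),
LINE g18-1, LAPLACE row, letter CHART∞ (V) «docking edition», part (c) of w3-20520 g13's FINAL HANDOFF (residual-gauge equivariance of `Φ_V`, invariance of `Jac_V`).

ABSTRACT over a fibred chart `(Φ, Jac, T)` of `Ū⁽ⁿ⁾` (the conjuncts of ✓IV-c `exists_fibredChart_iter_cont_blind` enter as hypotheses).  For a fine gauge
transformation `u` with induced level-`n` transformation `uₙ := transfUp u n` (✓`T4Continuum.iter_gaugeAct`: `Ū⁽ⁿ⁾(U^u) = (Ū⁽ⁿ⁾U)^{uₙ}`):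
* §1 `gaugeAct_extend` (gauge transforming a resampled field = resampling the transformed field at conjugated pivot values), `mem_chainWindow_gaugeAct_iff`
  (✓px17 `mem_cw_gaugeAct_iff` at the concrete chain), `image_T_gaugeAct` (the image windows transform by the two-sided translation of `uₙ`);
* §2 ★★ `chart_gaugeAct` — **EQUIVARIANCE OF THE CHART MAP**: at a live point, `Jac (uₙ • V, u • z) ≠ 0` and `Φ (uₙ • V, u • z) = u • Φ (V, z)` — by RECOGNITION
  (conjunct (13)) of the candidate `u • Φ (V, z)`: its pivot values lie in the transformed windows (§1), it agrees with `u • z` off the pivots (`charted`), and it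
  averages to `uₙ • V` (`hfib` + covariance of `Ū⁽ⁿ⁾`);
* §3 ★★ `jac_gaugeAct_ae_eq` — **INVARIANCE OF THE JACOBIAN, a.e.**: `Jac (uₙ • V, u • z) = Jac (V, z)` for `(μ_n ⊗ ν)`-a.e. `(V, z)` — the transformed pair
  `(Φ, Jac ∘ γᵤ)`, `γᵤ (V, z) := (uₙ • V, u • z)`, satisfies the SAME fibred law (conjunct (4): product-Haar invariance of `γᵤ`, covariance of `Ū⁽ⁿ⁾` and of the
  chart-window set, §2), both Jacobians are blind to the pivots, and a pivot-blind density is determined by the law (the law evaluates the weighted measure on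
  every rectangle `U₀ × {z | z[βₙ ↦ 1] ∈ C}`, a π-system generating the pivot-blind σ-algebra read through `(V, z) ↦ (V, z[βₙ ↦ 1])`).
The pointwise edition at strict-live points (continuity within the window graph + positivity of product Haar on the chart-window set) and the T3 instantiation
for the RESIDUAL group are CHART∞ V-b2.  [cite: Balaban1987RG1, (0.4) p.253, (2.1) p.265 and (2.10) p.267] [cite: Balaban1985Averaging, (8) p.19 and (11) p.19]
-/

noncomputable section

open MeasureTheory Filter Topology Set
open scoped ENNReal NNReal
open Literature.MathematicalPhysics.QuantumFieldTheory.Balaban1983to89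
open Literature.MathematicalPhysics.QuantumFieldTheory.Balaban1983to89.T4Continuum

namespace Summit.QuantumFields.YangMills.Theorems.FluctuationComparisonRegPrIntLS2BetaChartContCovariance

open Summit.QuantumFields.YangMills.Theorems.FluctuationComparisonRegPrIntLWregChain
open Summit.QuantumFields.YangMills.Theorems.FluctuationComparisonRegPrIntLWregFibredChart
open Summit.QuantumFields.YangMills.Theorems.FluctuationComparisonRegPrIntLWregChartChainCovariance
open Summit.QuantumFields.YangMills.Theorems.FluctuationComparisonRegPrIntLS2BetaChartContCarrier
open Function
open Literature.MathematicalPhysics.QuantumFieldTheory.Balaban1983to89.BlockAveraging (Idx loopHol measurable_avgFun)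
open Literature.MathematicalPhysics.QuantumFieldTheory.Balaban1983to89.BlockAveragingHaarAC (centralBond)
open Literature.MathematicalPhysics.QuantumFieldTheory.Balaban1983to89.ExpMeanLog (expMeanLogSU deltaSU measurable_expMeanLogSU_E)
open Literature.MathematicalPhysics.QuantumFieldTheory.Balaban1983to89.Node00 (SU)

variable {P : Params} {N : ℕ} [NeZero N]

/-! ## §1 Gauge transformations vs. resampling, windows and image windows -/

/-- Gauge transforming a resampled field is resampling the transformed field at the conjugated pivot values. [cite: Balaban1985Averaging, (8) p.19] -/
theorem gaugeAct_extend {n : ℕ} (hn : n ≤ P.m + P.K) (u : GaugeTransf P 0 (SU N)) (g : PBond P n → SU N) (z : GaugeField P 0 (SU N)) :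
    GaugeField.gaugeAct u (extend (iterCentralBond n) g z) =
      extend (iterCentralBond n) (fun c => u (iterCentralBond n c).src * g c * (u (iterCentralBond n c).tgt)⁻¹) (GaugeField.gaugeAct u z) := by
  have hβ := iterCentralBond_injective (P := P) (n := n) hn
  funext b
  by_cases hb : ∃ c, iterCentralBond n c = b
  · obtain ⟨c, rfl⟩ := hb
    simp only [GaugeField.gaugeAct, hβ.extend_apply]
  · simp only [GaugeField.gaugeAct, extend_apply' _ _ _ hb]

/-- ★ The iterated central window is gauge invariant up to conjugation of the pivot value (✓`mem_cw_gaugeAct_iff` at the concrete chain, every level realised by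
`transfUp`). [cite: Balaban1987RG1, (0.4) p.253 and (2.1) p.265] -/
theorem mem_chainWindow_gaugeAct_iff {α : ℝ} {n : ℕ} (hn : n ≤ P.m + P.K) (u : GaugeTransf P 0 (SU N)) (z : GaugeField P 0 (SU N)) (c : PBond P n)
    (g : SU N) :
    g ∈ chainWindow (N := N) α n z c ↔
      u (iterCentralBond n c).src * g * (u (iterCentralBond n c).tgt)⁻¹ ∈ chainWindow (N := N) α n (GaugeField.gaugeAct u z) c :=
  mem_cw_gaugeAct_iff (expMeanLogSU (n := Fin N)) iterCentralBond (chainMap (expMeanLogSU (n := Fin N))) (chainWindow (N := N) α)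
    (fun _ _ => rfl) (fun _ _ _ _ => rfl) (fun _ _ => rfl) (fun _ _ _ => rfl) u hn
    (fun k hk => ⟨transfUp u k, fun U => iter_gaugeAct _ u k (by omega) U⟩) z c g

/-- ★ The image windows transform by the two-sided translation of `uₙ` (✓`image_cw_gaugeAct`). [cite: Balaban1987RG1, (0.4) p.253 and (2.1) p.265] -/
theorem image_T_gaugeAct {α : ℝ} {n : ℕ} (hn : n ≤ P.m + P.K) {T : PBond P n → GaugeField P 0 (SU N) → Set (SU N)}
    (hTeq : ∀ c z, T c z = chainMap (expMeanLogSU (n := Fin N)) n z c '' chainWindow (N := N) α n z c)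
    (u : GaugeTransf P 0 (SU N)) (z : GaugeField P 0 (SU N)) (c : PBond P n) :
    T c (GaugeField.gaugeAct u z) = (fun x : SU N => transfUp u n c.src * x * (transfUp u n c.tgt)⁻¹) '' T c z := by
  rw [hTeq, hTeq]
  exact image_cw_gaugeAct (expMeanLogSU (n := Fin N)) iterCentralBond (chainMap (expMeanLogSU (n := Fin N))) (chainWindow (N := N) α)
    (fun _ _ => rfl) (fun _ _ _ _ => rfl) (fun _ _ => rfl) (fun _ _ _ => rfl) hn u (transfUp u n) (fun U => iter_gaugeAct _ u n hn U)
    (fun k hk => ⟨transfUp u k, fun U => iter_gaugeAct _ u k (by omega) U⟩) z c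

/-- Membership in the transformed image window: `v ∈ T c z ↔ uₙ(c₋) · v · uₙ(c₊)⁻¹ ∈ T c (u • z)`. [cite: Balaban1987RG1, (2.1) p.265] -/
theorem mem_T_gaugeAct_iff {α : ℝ} {n : ℕ} (hn : n ≤ P.m + P.K) {T : PBond P n → GaugeField P 0 (SU N) → Set (SU N)}
    (hTeq : ∀ c z, T c z = chainMap (expMeanLogSU (n := Fin N)) n z c '' chainWindow (N := N) α n z c)
    (u : GaugeTransf P 0 (SU N)) (z : GaugeField P 0 (SU N)) (c : PBond P n) (v : SU N) :
    v ∈ T c z ↔ transfUp u n c.src * v * (transfUp u n c.tgt)⁻¹ ∈ T c (GaugeField.gaugeAct u z) := by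
  rw [image_T_gaugeAct hn hTeq u z c]
  constructor
  · exact fun hv => mem_image_of_mem _ hv
  · rintro ⟨x, hx, hxv⟩
    dsimp only at hxv
    have hx' : x = v := mul_left_cancel (mul_right_cancel hxv)
    rw [← hx']; exact hx

/-! ## §2 Equivariance of the chart map -/

/-- ★★ **THE CHART MAP IS GAUGE EQUIVARIANT AT LIVE POINTS** — recognition of the candidate `u • Φ (V, z)`. [cite: Balaban1987RG1, (2.10) p.267; Balaban1985Averaging, (11) p.19] -/
theorem chart_gaugeAct {α : ℝ} {n : ℕ} (hn : n ≤ P.m + P.K)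
    {Φ : GaugeField P n (SU N) × GaugeField P 0 (SU N) → GaugeField P 0 (SU N)} {Jac : GaugeField P n (SU N) × GaugeField P 0 (SU N) → ℝ≥0}
    {T : PBond P n → GaugeField P 0 (SU N) → Set (SU N)}
    (hfib : ∀ V z, Jac (V, z) ≠ 0 →
      Averaging.iter (fun i => BlockAveraging.blockAvg (P := P) (j := i) (expMeanLogSU (n := Fin N))) n (Φ (V, z)) = V)
    (hJT : ∀ V z, Jac (V, z) ≠ 0 ↔ ∀ c, V c ∈ T c z)
    (hcharted : ∀ V z, (∀ c, V c ∈ T c z) → (∀ b, (∀ c, iterCentralBond n c ≠ b) → Φ (V, z) b = z b) ∧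
        ∀ c, Φ (V, z) (iterCentralBond n c) ∈ chainWindow (N := N) α n (Φ (V, z)) c)
    (hrecog : ∀ V z (g : PBond P n → SU N), (∀ c, g c ∈ chainWindow (N := N) α n z c) →
        (∀ c, V c = Averaging.iter (fun i => BlockAveraging.blockAvg (P := P) (j := i) (expMeanLogSU (n := Fin N))) n
          (extend (iterCentralBond n) g z) c) →
        Jac (V, z) ≠ 0 ∧ Φ (V, z) = extend (iterCentralBond n) g z)
    (u : GaugeTransf P 0 (SU N)) (V : GaugeField P n (SU N)) (z : GaugeField P 0 (SU N)) (hJ : Jac (V, z) ≠ 0) :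
    Jac (GaugeField.gaugeAct (transfUp u n) V, GaugeField.gaugeAct u z) ≠ 0 ∧
      Φ (GaugeField.gaugeAct (transfUp u n) V, GaugeField.gaugeAct u z) = GaugeField.gaugeAct u (Φ (V, z)) := by
  have hβ := iterCentralBond_injective (P := P) (n := n) hn
  have hV : ∀ c, V c ∈ T c z := (hJT V z).1 hJ
  have hext : extend (iterCentralBond n) (fun c => Φ (V, z) (iterCentralBond n c)) z = Φ (V, z) :=
    extend_chart_pivots_eq (P := P) (N := N) hn hcharted V z hV
  have hwin : ∀ c, Φ (V, z) (iterCentralBond n c) ∈ chainWindow (N := N) α n z c := fun c => by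
    have h := (hcharted V z hV).2 c
    rwa [← hext, chainWindow_extend α hn, hext] at h
  -- the candidate's pivot values and the three recognition inputs
  have hg : ∀ c, u (iterCentralBond n c).src * Φ (V, z) (iterCentralBond n c) * (u (iterCentralBond n c).tgt)⁻¹ ∈
      chainWindow (N := N) α n (GaugeField.gaugeAct u z) c := fun c => (mem_chainWindow_gaugeAct_iff hn u z c _).1 (hwin c)
  have hcand : extend (iterCentralBond n) (fun c => u (iterCentralBond n c).src * Φ (V, z) (iterCentralBond n c) * (u (iterCentralBond n c).tgt)⁻¹)
      (GaugeField.gaugeAct u z) = GaugeField.gaugeAct u (Φ (V, z)) := by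
    rw [← gaugeAct_extend hn u (fun c => Φ (V, z) (iterCentralBond n c)) z, hext]
  have havg : ∀ c, GaugeField.gaugeAct (transfUp u n) V c =
      Averaging.iter (fun i => BlockAveraging.blockAvg (P := P) (j := i) (expMeanLogSU (n := Fin N))) n
        (extend (iterCentralBond n) (fun c => u (iterCentralBond n c).src * Φ (V, z) (iterCentralBond n c) * (u (iterCentralBond n c).tgt)⁻¹)
          (GaugeField.gaugeAct u z)) c := fun c => by
    rw [hcand, iter_gaugeAct _ u n hn, hfib V z hJ]
  obtain ⟨hJ', hΦ'⟩ := hrecog _ _ _ hg havg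
  exact ⟨hJ', hΦ'.trans hcand⟩

/-! ## §3 Invariance of the Jacobian, almost everywhere -/

omit [NeZero N] in
/-- `transfUp` commutes with pointwise inversion. [cite: Balaban1985Averaging, (11) p.19] -/
theorem transfUp_inv (u : GaugeTransf P 0 (SU N)) :
    ∀ k : ℕ, transfUp (fun x => (u x)⁻¹ : GaugeTransf P 0 (SU N)) k = (fun y => (transfUp u k y)⁻¹ : GaugeTransf P k (SU N))
  | 0 => rfl
  | k + 1 => by
      funext y
      show transfUp (fun x => (u x)⁻¹ : GaugeTransf P 0 (SU N)) k (emb y) = (transfUp u k (emb y))⁻¹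
      rw [transfUp_inv u k]

/-- `U^{u}` followed by `U^{u⁻¹}` is the identity. [cite: Balaban1985Averaging, (8) p.19] -/
theorem gaugeAct_inv_gaugeAct {j : ℕ} (u : GaugeTransf P j (SU N)) (U : GaugeField P j (SU N)) :
    GaugeField.gaugeAct (fun x => (u x)⁻¹ : GaugeTransf P j (SU N)) (GaugeField.gaugeAct u U) = U := by
  funext b
  simp only [GaugeField.gaugeAct, inv_inv]
  group

/-- The chart-window set `{U | ∀ c, U (βₙc) ∈ chainWindow α n U c}` is gauge invariant. [cite: Balaban1987RG1, (0.4) p.253 and (2.1) p.265] -/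
theorem mem_chartWindowSet_gaugeAct_iff {α : ℝ} {n : ℕ} (hn : n ≤ P.m + P.K) (u : GaugeTransf P 0 (SU N)) (z : GaugeField P 0 (SU N)) :
    (∀ c, GaugeField.gaugeAct u z (iterCentralBond n c) ∈ chainWindow (N := N) α n (GaugeField.gaugeAct u z) c) ↔
      ∀ c, z (iterCentralBond n c) ∈ chainWindow (N := N) α n z c :=
  forall_congr' fun c => (mem_chainWindow_gaugeAct_iff hn u z c (z (iterCentralBond n c))).symm

/-- The chart-window set is measurable. [cite: Balaban1987RG1, (2.9) p.266 (bookkeeping)] -/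
theorem measurableSet_chartWindowSet (α : ℝ) (n : ℕ) :
    MeasurableSet {U : GaugeField P 0 (SU N) | ∀ c, U (iterCentralBond n c) ∈ chainWindow (N := N) α n U c} := by
  have h : {U : GaugeField P 0 (SU N) | ∀ c, U (iterCentralBond n c) ∈ chainWindow (N := N) α n U c} =
      ⋂ c, (fun U : GaugeField P 0 (SU N) => ((U, U (iterCentralBond n c)) : GaugeField P 0 (SU N) × SU N)) ⁻¹'
        {p : GaugeField P 0 (SU N) × SU N | p.2 ∈ chainWindow (N := N) α n p.1 c} := by
    ext U; simp only [mem_setOf_eq, mem_iInter, mem_preimage]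
  rw [h]
  exact MeasurableSet.iInter fun c => (measurable_id.prodMk (measurable_pi_apply _)) (measurableSet_chainWindow₂ α n c)

/-- ★★ **THE JACOBIAN IS GAUGE INVARIANT ALMOST EVERYWHERE**: `Jac (uₙ • V, u • z) = Jac (V, z)` for `(μ_n ⊗ ν)`-a.e. `(V, z)` — the transformed pair
`(Φ, Jac ∘ γᵤ)` obeys the same fibred law (product-Haar invariance of `γᵤ`, covariance of `Ū⁽ⁿ⁾` and of the chart-window set, §2 for `Φ`), both Jacobians are
pivot-blind, and a pivot-blind density is determined by the law: push forward along `π (V, z) := (V, z[βₙ ↦ 1])`, where the law evaluates the weighted measures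
on all rectangles (a generating π-system, `ext_of_generate_finite`), then `withDensity_eq_iff_of_sigmaFinite` and pull back.
[cite: Balaban1987RG1, (0.4) p.253, (2.1) p.265 and (2.10) p.267] [cite: Balaban1985Averaging, (8) p.19 and (11) p.19] -/
theorem jac_gaugeAct_ae_eq {α : ℝ} {n : ℕ} (hn : n ≤ P.m + P.K)
    {Φ : GaugeField P n (SU N) × GaugeField P 0 (SU N) → GaugeField P 0 (SU N)} {Jac : GaugeField P n (SU N) × GaugeField P 0 (SU N) → ℝ≥0}
    {T : PBond P n → GaugeField P 0 (SU N) → Set (SU N)}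
    (hΦm : Measurable Φ) (hJm : Measurable Jac)
    (hfib : ∀ V z, Jac (V, z) ≠ 0 →
      Averaging.iter (fun i => BlockAveraging.blockAvg (P := P) (j := i) (expMeanLogSU (n := Fin N))) n (Φ (V, z)) = V)
    (hlaw : ∀ U₀ : Set (GaugeField P n (SU N)), MeasurableSet U₀ →
      (fieldMeasure P 0 (SU N)).restrict
          (Averaging.iter (fun i => BlockAveraging.blockAvg (P := P) (j := i) (expMeanLogSU (n := Fin N))) n ⁻¹' U₀ ∩
            {U | ∀ c, U (iterCentralBond n c) ∈ chainWindow (N := N) α n U c}) =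
        ((((fieldMeasure P n (SU N)).restrict U₀).prod (fieldMeasure P 0 (SU N))).withDensity fun p => (Jac p : ℝ≥0∞)).map Φ)
    (hJT : ∀ V z, Jac (V, z) ≠ 0 ↔ ∀ c, V c ∈ T c z)
    (hcharted : ∀ V z, (∀ c, V c ∈ T c z) → (∀ b, (∀ c, iterCentralBond n c ≠ b) → Φ (V, z) b = z b) ∧
        ∀ c, Φ (V, z) (iterCentralBond n c) ∈ chainWindow (N := N) α n (Φ (V, z)) c)
    (hrecog : ∀ V z (g : PBond P n → SU N), (∀ c, g c ∈ chainWindow (N := N) α n z c) →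
        (∀ c, V c = Averaging.iter (fun i => BlockAveraging.blockAvg (P := P) (j := i) (expMeanLogSU (n := Fin N))) n
          (extend (iterCentralBond n) g z) c) →
        Jac (V, z) ≠ 0 ∧ Φ (V, z) = extend (iterCentralBond n) g z)
    (hJbl : ∀ V z (g : PBond P n → SU N), Jac (V, extend (iterCentralBond n) g z) = Jac (V, z))
    (u : GaugeTransf P 0 (SU N)) :
    ∀ᵐ p ∂(fieldMeasure P n (SU N)).prod (fieldMeasure P 0 (SU N)),
      Jac (GaugeField.gaugeAct (transfUp u n) p.1, GaugeField.gaugeAct u p.2) = Jac p := by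
  classical
  haveI : IsProbabilityMeasure (HaarData.haar (G := SU N)) := HaarData.isProb
  haveI : BorelSpace (GaugeField P 0 (SU N)) := inferInstanceAs (BorelSpace (PBond P 0 → SU N))
  haveI : BorelSpace (GaugeField P n (SU N)) := inferInstanceAs (BorelSpace (PBond P n → SU N))
  have hβ := iterCentralBond_injective (P := P) (n := n) hn
  set μ : Measure (GaugeField P n (SU N)) := fieldMeasure P n (SU N) with hμ
  set ν : Measure (GaugeField P 0 (SU N)) := fieldMeasure P 0 (SU N) with hν
  set A := Averaging.iter (fun i => BlockAveraging.blockAvg (P := P) (j := i) (expMeanLogSU (n := Fin N))) n with hA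
  have hAm : Measurable A :=
    T4Continuum.measurable_iter _ (fun j => by rw [BlockAveraging.blockAvg_avg]; exact measurable_avgFun _ measurable_expMeanLogSU_E) n
  have hCWm : MeasurableSet {U : GaugeField P 0 (SU N) | ∀ c, U (iterCentralBond n c) ∈ chainWindow (N := N) α n U c} :=
    measurableSet_chartWindowSet α n
  -- the three gauge maps and the product map `γ`
  set gV : GaugeField P n (SU N) → GaugeField P n (SU N) := GaugeField.gaugeAct (transfUp u n) with hgV
  set gz : GaugeField P 0 (SU N) → GaugeField P 0 (SU N) := GaugeField.gaugeAct u with hgz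
  set gzi : GaugeField P 0 (SU N) → GaugeField P 0 (SU N) := GaugeField.gaugeAct (fun x => (u x)⁻¹ : GaugeTransf P 0 (SU N)) with hgzi
  have hgVm : Measurable gV := B12RTGaugeInvariance254.measurable_gaugeAct _
  have hgzm : Measurable gz := B12RTGaugeInvariance254.measurable_gaugeAct _
  have hgzim : Measurable gzi := B12RTGaugeInvariance254.measurable_gaugeAct _
  have hpresV : MeasurePreserving gV μ μ := B12RTGaugeInvariance254.measurePreserving_gaugeAct _
  have hpresz : MeasurePreserving gz ν ν := B12RTGaugeInvariance254.measurePreserving_gaugeAct _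
  have hpreszi : MeasurePreserving gzi ν ν := B12RTGaugeInvariance254.measurePreserving_gaugeAct _
  set γ : GaugeField P n (SU N) × GaugeField P 0 (SU N) → GaugeField P n (SU N) × GaugeField P 0 (SU N) := fun p => (gV p.1, gz p.2) with hγ
  have hγm : Measurable γ := (hgVm.comp measurable_fst).prodMk (hgzm.comp measurable_snd)
  set J : GaugeField P n (SU N) × GaugeField P 0 (SU N) → ℝ≥0∞ := fun p => (Jac p : ℝ≥0∞) with hJ
  have hJmeas : Measurable J := hJm.coe_nnreal_ennreal
  -- §2 read backwards: at a `J ∘ γ`-live point, `Φ p = u⁻¹ • Φ (γ p)` and `p` is live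
  have hback : ∀ p : GaugeField P n (SU N) × GaugeField P 0 (SU N), Jac (γ p) ≠ 0 → Jac p ≠ 0 ∧ Φ p = gzi (Φ (γ p)) := by
    intro p hp
    have h := chart_gaugeAct (P := P) (N := N) hn hfib hJT hcharted hrecog (fun x => (u x)⁻¹ : GaugeTransf P 0 (SU N)) (γ p).1 (γ p).2 hp
    have h1 : GaugeField.gaugeAct (transfUp (fun x => (u x)⁻¹ : GaugeTransf P 0 (SU N)) n) (γ p).1 = p.1 := by
      show GaugeField.gaugeAct (transfUp (fun x => (u x)⁻¹ : GaugeTransf P 0 (SU N)) n) (GaugeField.gaugeAct (transfUp u n) p.1) = p.1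
      rw [transfUp_inv]
      exact gaugeAct_inv_gaugeAct _ _
    have h2 : GaugeField.gaugeAct (fun x => (u x)⁻¹ : GaugeTransf P 0 (SU N)) (γ p).2 = p.2 := gaugeAct_inv_gaugeAct _ _
    rw [h1, h2] at h
    exact h
  -- Step 1: the fibred law for `J ∘ γ`
  have hlawu : ∀ U₀ : Set (GaugeField P n (SU N)), MeasurableSet U₀ →
      ν.restrict (A ⁻¹' U₀ ∩ {U | ∀ c, U (iterCentralBond n c) ∈ chainWindow (N := N) α n U c}) =
        (((μ.restrict U₀).prod ν).withDensity (J ∘ γ)).map Φ := by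
    intro U₀ hU₀
    set U₁ : Set (GaugeField P n (SU N)) := GaugeField.gaugeAct (fun y => (transfUp u n y)⁻¹ : GaugeTransf P n (SU N)) ⁻¹' U₀ with hU₁
    have hU₁m : MeasurableSet U₁ := (B12RTGaugeInvariance254.measurable_gaugeAct _) hU₀
    have hpre : gV ⁻¹' U₁ = U₀ := by
      ext V
      simp only [hU₁, mem_preimage, hgV]
      rw [gaugeAct_inv_gaugeAct]
    have hmapγ : ((μ.restrict U₀).prod ν).map γ = (μ.restrict U₁).prod ν := by
      rw [show γ = Prod.map gV gz from rfl, ← Measure.map_prod_map _ _ hgVm hgzm, hpresz.map_eq, ← hpre,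
        ← Measure.restrict_map hgVm hU₁m, hpresV.map_eq]
    have hwd : (((μ.restrict U₀).prod ν).withDensity (J ∘ γ)).map γ = ((μ.restrict U₁).prod ν).withDensity J := by
      rw [← hmapγ, withDensity_map_eq_map_withDensity_comp _ hγm hJmeas]
    have hΦae : (fun p => Φ p) =ᵐ[((μ.restrict U₀).prod ν).withDensity (J ∘ γ)] fun p => gzi (Φ (γ p)) := by
      rw [Filter.EventuallyEq, ae_withDensity_iff (hJmeas.comp hγm)]
      refine ae_of_all _ fun p hp => ?_
      have hp' : Jac (γ p) ≠ 0 := by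
        intro h0; apply hp
        show (Jac (γ p) : ℝ≥0∞) = 0
        rw [h0, ENNReal.coe_zero]
      exact (hback p hp').2
    -- the preimage of the live set of `U₀` under `u⁻¹ •` is the live set of `U₁`
    have hpre' : gzi ⁻¹' (A ⁻¹' U₀ ∩ {U | ∀ c, U (iterCentralBond n c) ∈ chainWindow (N := N) α n U c}) =
        A ⁻¹' U₁ ∩ {U | ∀ c, U (iterCentralBond n c) ∈ chainWindow (N := N) α n U c} := by
      ext z
      simp only [mem_preimage, mem_inter_iff, mem_setOf_eq, hgzi, hU₁]
      rw [mem_chartWindowSet_gaugeAct_iff hn (fun x => (u x)⁻¹ : GaugeTransf P 0 (SU N)) z, hA,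
        iter_gaugeAct _ (fun x => (u x)⁻¹ : GaugeTransf P 0 (SU N)) n hn z, transfUp_inv]
    have hmeasS : MeasurableSet (A ⁻¹' U₀ ∩ {U | ∀ c, U (iterCentralBond n c) ∈ chainWindow (N := N) α n U c}) := (hAm hU₀).inter hCWm
    calc ν.restrict (A ⁻¹' U₀ ∩ {U | ∀ c, U (iterCentralBond n c) ∈ chainWindow (N := N) α n U c})
        = (ν.map gzi).restrict (A ⁻¹' U₀ ∩ {U | ∀ c, U (iterCentralBond n c) ∈ chainWindow (N := N) α n U c}) := by rw [hpreszi.map_eq]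
      _ = (ν.restrict (A ⁻¹' U₁ ∩ {U | ∀ c, U (iterCentralBond n c) ∈ chainWindow (N := N) α n U c})).map gzi := by
          rw [Measure.restrict_map hgzim hmeasS, hpre']
      _ = ((((μ.restrict U₁).prod ν).withDensity J).map Φ).map gzi := by rw [hlaw U₁ hU₁m]
      _ = (((((μ.restrict U₀).prod ν).withDensity (J ∘ γ)).map γ).map Φ).map gzi := by rw [hwd]
      _ = (((μ.restrict U₀).prod ν).withDensity (J ∘ γ)).map (fun p => gzi (Φ (γ p))) := by
          rw [Measure.map_map hΦm hγm, Measure.map_map hgzim (hΦm.comp hγm)]; rfl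
      _ = (((μ.restrict U₀).prod ν).withDensity (J ∘ γ)).map Φ := (Measure.map_congr hΦae).symm
  -- Step 2: evaluation on rectangles read through `π (V, z) := (V, z[βₙ ↦ 1])`
  set ext1 : GaugeField P 0 (SU N) → GaugeField P 0 (SU N) := fun z => extend (iterCentralBond n) (fun _ => (1 : SU N)) z with hext1
  have hext1m : Measurable ext1 := by
    refine measurable_pi_lambda _ fun b => ?_
    by_cases hb : ∃ c, iterCentralBond n c = b
    · obtain ⟨c, rfl⟩ := hb
      simp only [hext1, hβ.extend_apply]
      exact measurable_const
    · simp only [hext1, extend_apply' _ _ _ hb]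
      exact measurable_pi_apply b
  set π : GaugeField P n (SU N) × GaugeField P 0 (SU N) → GaugeField P n (SU N) × GaugeField P 0 (SU N) :=
    fun p => (p.1, ext1 p.2) with hπ
  have hπm : Measurable π := measurable_fst.prodMk (hext1m.comp measurable_snd)
  have hrect : ∀ f : GaugeField P n (SU N) × GaugeField P 0 (SU N) → ℝ≥0∞, Measurable f →
      (∀ p, f p ≠ 0 → Jac p ≠ 0) →
      (∀ U₀ : Set (GaugeField P n (SU N)), MeasurableSet U₀ →
        ν.restrict (A ⁻¹' U₀ ∩ {U | ∀ c, U (iterCentralBond n c) ∈ chainWindow (N := N) α n U c}) =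
          (((μ.restrict U₀).prod ν).withDensity f).map Φ) →
      ∀ (U₀ : Set (GaugeField P n (SU N))) (C : Set (GaugeField P 0 (SU N))), MeasurableSet U₀ → MeasurableSet C →
        (((μ.prod ν).withDensity f).map π) (U₀ ×ˢ C) =
          ν (A ⁻¹' U₀ ∩ {U | ∀ c, U (iterCentralBond n c) ∈ chainWindow (N := N) α n U c} ∩ ext1 ⁻¹' C) := by
    intro f hf hlive hlawf U₀ C hU₀ hC
    have hmeasS : MeasurableSet (A ⁻¹' U₀ ∩ {U | ∀ c, U (iterCentralBond n c) ∈ chainWindow (N := N) α n U c}) := (hAm hU₀).inter hCWm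
    -- the law of `f` evaluated on the pivot-blind cylinder `ext1 ⁻¹' C`
    have h1 : ν (A ⁻¹' U₀ ∩ {U | ∀ c, U (iterCentralBond n c) ∈ chainWindow (N := N) α n U c} ∩ ext1 ⁻¹' C) =
        ∫⁻ p in U₀ ×ˢ univ, (Φ ⁻¹' (ext1 ⁻¹' C)).indicator f p ∂μ.prod ν := by
      have hS : MeasurableSet (Φ ⁻¹' (ext1 ⁻¹' C)) := hΦm (hext1m hC)
      rw [lintegral_indicator hS, Measure.restrict_restrict hS,
        show A ⁻¹' U₀ ∩ {U | ∀ c, U (iterCentralBond n c) ∈ chainWindow (N := N) α n U c} ∩ ext1 ⁻¹' C =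
          ext1 ⁻¹' C ∩ (A ⁻¹' U₀ ∩ {U | ∀ c, U (iterCentralBond n c) ∈ chainWindow (N := N) α n U c}) from inter_comm _ _,
        ← Measure.restrict_apply (hext1m hC), hlawf U₀ hU₀, Measure.map_apply hΦm (hext1m hC), withDensity_apply _ hS,
        Measure.restrict_prod_eq_prod_univ, Measure.restrict_restrict hS]
    have h2 : (((μ.prod ν).withDensity f).map π) (U₀ ×ˢ C) =
        ∫⁻ p in U₀ ×ˢ univ, {p : GaugeField P n (SU N) × GaugeField P 0 (SU N) | ext1 p.2 ∈ C}.indicator f p ∂μ.prod ν := by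
      have hS : MeasurableSet {p : GaugeField P n (SU N) × GaugeField P 0 (SU N) | ext1 p.2 ∈ C} := (hext1m.comp measurable_snd) hC
      have hπpre : π ⁻¹' (U₀ ×ˢ C) = {p : GaugeField P n (SU N) × GaugeField P 0 (SU N) | ext1 p.2 ∈ C} ∩ U₀ ×ˢ univ := by
        ext p
        simp only [hπ, mem_preimage, mem_prod, mem_inter_iff, mem_setOf_eq, mem_univ, and_true]
        exact and_comm
      rw [lintegral_indicator hS, Measure.restrict_restrict hS, Measure.map_apply hπm (hU₀.prod hC),
        withDensity_apply _ (hπm (hU₀.prod hC)), hπpre]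
    rw [h2, h1]
    refine lintegral_congr fun p => ?_
    -- the two indicators agree wherever `f p ≠ 0` (live ⇒ `Φ p` has the off-pivot coordinates of `p.2`)
    by_cases hfp : f p = 0
    · simp only [indicator, hfp, ite_self]
    · have hJp := hlive p hfp
      have hoff := (hcharted p.1 p.2 ((hJT p.1 p.2).1 hJp)).1
      have hext : ext1 (Φ p) = ext1 p.2 := by
        funext b
        simp only [hext1]
        by_cases hb : ∃ c, iterCentralBond n c = b
        · obtain ⟨c, rfl⟩ := hb
          rw [hβ.extend_apply, hβ.extend_apply]
        · rw [extend_apply' _ _ _ hb, extend_apply' _ _ _ hb]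
          exact hoff b fun c hc => hb ⟨c, hc⟩
      by_cases hmem : ext1 p.2 ∈ C
      · rw [indicator_of_mem (show p ∈ Φ ⁻¹' (ext1 ⁻¹' C) by rw [mem_preimage, mem_preimage, hext]; exact hmem),
          indicator_of_mem (show p ∈ {p : GaugeField P n (SU N) × GaugeField P 0 (SU N) | ext1 p.2 ∈ C} from hmem)]
      · rw [indicator_of_notMem (show p ∉ Φ ⁻¹' (ext1 ⁻¹' C) by rw [mem_preimage, mem_preimage, hext]; exact hmem),
          indicator_of_notMem (show p ∉ {p : GaugeField P n (SU N) × GaugeField P 0 (SU N) | ext1 p.2 ∈ C} from hmem)]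
  -- the two weighted measures, finite, agree after `π`
  have hliveJ : ∀ p, J p ≠ 0 → Jac p ≠ 0 := fun p hp h0 => hp (by show (Jac p : ℝ≥0∞) = 0; rw [h0, ENNReal.coe_zero])
  have hliveJu : ∀ p, (J ∘ γ) p ≠ 0 → Jac p ≠ 0 := fun p hp =>
    (hback p fun h0 => hp (by show (Jac (γ p) : ℝ≥0∞) = 0; rw [h0, ENNReal.coe_zero])).1
  have hlawJ : ∀ U₀ : Set (GaugeField P n (SU N)), MeasurableSet U₀ →
      ν.restrict (A ⁻¹' U₀ ∩ {U | ∀ c, U (iterCentralBond n c) ∈ chainWindow (N := N) α n U c}) =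
        (((μ.restrict U₀).prod ν).withDensity J).map Φ := fun U₀ hU₀ => hlaw U₀ hU₀
  have hRJ := hrect J hJmeas hliveJ hlawJ
  have hRJu := hrect (J ∘ γ) (hJmeas.comp hγm) hliveJu hlawu
  have hfinJ : IsFiniteMeasure (((μ.prod ν).withDensity J).map π) := by
    refine ⟨?_⟩
    rw [← univ_prod_univ, hRJ univ univ MeasurableSet.univ MeasurableSet.univ]
    exact measure_lt_top _ _
  have hMeq : ((μ.prod ν).withDensity J).map π = ((μ.prod ν).withDensity (J ∘ γ)).map π := by
    haveI := hfinJ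
    refine ext_of_generate_finite _ generateFrom_prod.symm isPiSystem_prod (fun s hs => ?_) ?_
    · obtain ⟨U₀, hU₀, C, hC, rfl⟩ := hs
      rw [hRJ U₀ C hU₀ hC, hRJu U₀ C hU₀ hC]
    · rw [← univ_prod_univ, hRJ univ univ MeasurableSet.univ MeasurableSet.univ, hRJu univ univ MeasurableSet.univ MeasurableSet.univ]
  -- both densities are blind to the pivots: read them through `π`
  have hJπ : J ∘ π = J := by
    funext p
    show (Jac (p.1, extend (iterCentralBond n) (fun _ => (1 : SU N)) p.2) : ℝ≥0∞) = Jac p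
    rw [hJbl]
  have hJγπ : (J ∘ γ) ∘ π = J ∘ γ := by
    funext p
    show (Jac (gV p.1, gz (extend (iterCentralBond n) (fun _ => (1 : SU N)) p.2)) : ℝ≥0∞) = Jac (gV p.1, gz p.2)
    rw [hgz, gaugeAct_extend hn, hJbl]
  have hM : ((μ.prod ν).withDensity J).map π = ((μ.prod ν).map π).withDensity J := by
    rw [withDensity_map_eq_map_withDensity_comp _ hπm hJmeas, hJπ]
  have hMu : ((μ.prod ν).withDensity (J ∘ γ)).map π = ((μ.prod ν).map π).withDensity (J ∘ γ) := by
    rw [withDensity_map_eq_map_withDensity_comp _ hπm (hJmeas.comp hγm), hJγπ]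
  have hae : J =ᵐ[(μ.prod ν).map π] (J ∘ γ) :=
    (withDensity_eq_iff_of_sigmaFinite hJmeas.aemeasurable (hJmeas.comp hγm).aemeasurable).1 (by rw [← hM, ← hMu, hMeq])
  have h2 : ∀ᵐ p ∂μ.prod ν, J (π p) = (J ∘ γ) (π p) := ae_of_ae_map hπm.aemeasurable hae
  filter_upwards [h2] with p hp
  have hp' : J p = (J ∘ γ) p := by
    rw [← congrFun hJπ p, ← congrFun hJγπ p]
    exact hp
  have hp'' : (Jac p : ℝ≥0∞) = Jac (gV p.1, gz p.2) := hp'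
  exact_mod_cast hp''.symm

end Summit.QuantumFields.YangMills.Theorems.FluctuationComparisonRegPrIntLS2BetaChartContCovariance

end
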